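import Literature.NumberTheory.EllipticCurves.ModularParametrizationDegreeProofs
import Literature.NumberTheory.EllipticCurves.ManinConstantGamma1Gamma0Comparison
import HarnessLib

/-!
# The flat `X₁(N)`-datum on the `X₀(N)`-optimal curve in the index-`4`, `c₀`-even world
(route `ManinLocalTwoThree`, crux C2 `ManinOddAtFour` stmt-BirchSwinnertonDyer-22967; cell bsd-f2-manin, prover seat p2 gen 22;
`--supports stmt-BirchSwinnertonDyer-22967`)

PURPOSE.  The C2 conditional closer of the LEAD line `kummer_diamond` (`…KummerDiamondIndexFourShapeFlat`,
`maninOddAtFour_of_CDT_CES_Tes75 : CDT → CES → T-es-75 → ManinOddAtFour`) consumes the printed fact CES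
(`exists_optimal_gamma1ParametrizationData`, Conrad–Edixhoven–Stein 2003 / Stevens 1989: SOME curve of the isogeny class carries an
OPTIMAL `X₁(N)`-datum) only inside the index-`4` world `Λ₁(f) = 2Λ₀(f)` with `c₀` even (`|c₀| = 2` after CDT).  THERE the
`X₀(N)`-optimal curve `W₀` ITSELF carries an optimal `X₁(N)`-datum: `Λ_{W₀} = c₀Λ₀(f) = (c₀/2)·Λ₁(f)`, so the datum
`(f, Λ_{W₀}, π₀, c := c₀/2)` is an OPTIMAL `Gamma1ParametrizationData W₀ N` — provided the one honest field of that hypothesis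
structure, `deg_spec` (all but finitely many points have the same number `deg` of `Γ₁(N)`-orbits in their fibre), can be PROVED for
the map `Γ₁(N)τ ↦ π₀((c₀/2)·2πi∫_{i∞}^τ f)`.  It can: the tree theorem `exists_modularDegree_holds`
(`ModularParametrizationDegreeProofs.lean`, the Farkas–Kra count "a non-constant holomorphic map of compact Riemann surfaces has a
degree", argued on `ℍ`) is written for a general subgroup `Γ ≤ SL(2, ℤ)` in all its lemmas; §1 below is its `Γ₁(N)` twin.

CONTENTS.
* §1 `exists_gamma1_modularDegree` — for `f ≠ 0` in `S₂(Γ₀(N))`, a period pair `L` and `c ≠ 0` with `c·Λ₁(f) ⊆ Λ_L`, there is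
  `d ≥ 1` such that off a finite subset of `ℂ/Λ_L` the fibres of `Γ₁(N)τ ↦ c·2πi∫_{i∞}^τ f (mod Λ_L)` consist of exactly `d` orbits
  (adapted from `exists_modularDegree_holds`, `Γ₀(N) ↦ Γ₁(N)`).
* §2 `exists_flat_gamma1ParametrizationData` — for an `X₀(N)`-datum `D₀` of `W₀` with the lattice clause, `2 ∣ c₀` and
  `Λ₁(f) = 2Λ₀(f)`: an OPTIMAL `X₁(N)`-datum `D₁` of `W₀` with `D₁.f = D₀.f`, `D₁.L = D₀.L`, `D₁.uniformize = D₀.uniformize`,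
  `2·D₁.c = D₀.c` (existence only — no definition is introduced).

HONEST FRAMING.  Pure bookkeeping inside the tree's hypothesis structures; no printed fact is used or discharged; Manin's conjecture,
C2 and BSD are NOT proved here.  The consumer (`…KummerDiamondIndexFourShapeNoCES`) removes CES from the C2 closer:
`ManinOddAtFour ⟸ CDT ∧ T-es-75`.  No definitions, no sorry.
[cite: FarkasKra1992, Prop. I.1.6] [cite: DiamondShurman2005, §3.1 (p. 65), §2.4] [cite: CesnaviciusNeururerSaha2023, §1 and Lemma 6.5]
-/

set_option autoImplicit false
-- lint-debt: the directory name repeats the summit name (sibling precedent `ManinLocalTwoThreeKummerDiamondIndexFourShape.lean`)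
set_option linter.dupNamespace false

noncomputable section

open scoped MatrixGroups ModularForm Modular Topology Manifold
open CongruenceSubgroup Complex Filter Set Function
open UpperHalfPlane hiding I
open Literature.NumberTheory.EllipticCurves.ModularForms

namespace Summit.BirchSwinnertonDyer.BirchSwinnertonDyer.Theorems.ManinLocalTwoThree.FlatGamma1Datum

/-! ## §1 The `X₁(N)`-parametrisation `Γ₁(N) \ ℍ → ℂ/Λ` has a degree -/

section Degree

variable {N : ℕ} {k : ℤ}

/-- **The zeros of a non-zero cusp form on `Γ₀(N)` lie in finitely many `Γ₁(N)`-orbits**: there is a finite `F₀ ⊆ ℍ` with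
`{f = 0} ⊆ Γ₁(N) F₀` (reduction theory for the finite-index subgroup `Γ₁(N)`: every point is `γ g z` with `z` in the compact
`𝒟_M` or of height `> M`; above height `M` no translate `f(g ·)` vanishes, and the zeros in the compact `⋃_g g𝒟_M` are finite —
the `Γ₁(N)` twin of `exists_finite_zeros_subset_smul`). [cite: DiamondShurman2005, §3.1] -/
theorem exists_finite_zeros_subset_gamma1_smul [NeZero N] (f : CuspForm (Gamma0 N) k) (hf : f ≠ 0) :
    ∃ F₀ : Set ℍ, F₀.Finite ∧ ∀ τ : ℍ, f τ = 0 → ∃ γ ∈ Gamma1 N, ∃ z ∈ F₀, τ = γ • z := by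
  obtain ⟨R, hR⟩ := exists_finset_smul_truncatedFundamentalDomain_cover (Gamma1 N)
  have hM : ∀ g ∈ R, ∀ᶠ M : ℝ in atTop, ∀ z : ℍ, M < z.im → f (g • z) ≠ 0 := by
    intro g _
    obtain ⟨M, hM⟩ := exists_forall_apply_smul_ne_zero f hf g
    filter_upwards [eventually_ge_atTop M] with M' hM' z hz
    exact hM z (hM'.trans hz.le)
  obtain ⟨M, hM⟩ := ((R.eventually_all).mpr hM).exists
  have hK := isCompact_biUnion_smul_truncatedFundamentalDomain R M
  have hf0 : (⇑f : ℍ → ℂ) ≠ 0 := fun h ↦ hf (DFunLike.coe_injective (h.trans (by rfl)))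
  refine ⟨{τ | f τ = 0} ∩ ⋃ g ∈ R, (g • ·) '' ModularGroup.truncatedFundamentalDomain M,
    finite_zeros_inter_of_isCompact (isCuspFunction_one f).mdifferentiable hf0 hK, ?_⟩
  intro τ hτ
  obtain ⟨γ, hγ, g, hg, z, rfl, hz⟩ := hR M τ
  have h1 : f (g • z) = 0 := (apply_smul_eq_zero_iff f (Gamma1_in_Gamma0 N hγ) (g • z)).mp hτ
  rcases hz with hz | hz
  · exact ⟨γ, hγ, g • z, ⟨h1, mem_iUnion₂.mpr ⟨g, hg, z, hz, rfl⟩⟩, rfl⟩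
  · exact absurd h1 (hM g hg z hz)

/-- **The `X₁(N)`-parametrisation has a degree** (the `Γ₁(N)` twin of `exists_modularDegree_holds`): for a non-zero
`f ∈ S₂(Γ₀(N))`, a period pair `L` and `c ≠ 0` with `c·Λ₁(f) ⊆ Λ_L` (`Λ₁(f) = periodLatticeGamma1 f`), there is `d ≥ 1` such
that off a finite subset of `ℂ/Λ_L` the fibres of `Γ₁(N)τ ↦ c · 2πi ∫_{i∞}^τ f (mod Λ_L)` consist of exactly `d` orbits
`Γ₁(N)τ ∈ Y₁(N)`.  Printed source: "a non-constant holomorphic map between compact Riemann surfaces has a degree" (Farkas–Kra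
Prop. I.1.6; Diamond–Shurman §3.1, p. 65) applied to `X₁(N) → ℂ/Λ_L`; the proof is that of `exists_modularDegree_holds` verbatim
with `Γ₀(N)` replaced by `Γ₁(N)` (reduction theory for `Γ₁(N)`, cusp expansions `2πi∫_{i∞}^{gz} f = C_g + V_{f|g}(z)`, local
finiteness of the zeros of `f`, the inverse function theorem at non-zeros of `f`, proper discontinuity, connectedness of the
complement of the countable exceptional set). [cite: FarkasKra1992, Prop. I.1.6] [cite: DiamondShurman2005, §3.1 (p. 65), §2.4] -/
theorem exists_gamma1_modularDegree [NeZero N] {f : CuspForm (Gamma0 N) 2} (hf : f ≠ 0) {L : PeriodPair} {c : ℂ}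
    (hc0 : c ≠ 0) (hc : ∀ z ∈ periodLatticeGamma1 f, c * z ∈ L.lattice) :
    ∃ d : ℕ, 0 < d ∧
      {P : ℂ ⧸ L.lattice.toAddSubgroup |
          Nat.card {y : Y1 N // ∃ τ : ℍ, Y1.mk N τ = y ∧
            ((c * eichlerIntegral f τ : ℂ) : ℂ ⧸ L.lattice.toAddSubgroup) = P} ≠ d}.Finite := by
  classical
  set Ψ : ℍ → ℂ := fun τ ↦ c * eichlerIntegral f τ with hΨdef
  set Λ : AddSubgroup ℂ := L.lattice.toAddSubgroup with hΛdef
  -- the lattice `Λ` is closed, discrete and countable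
  have hΛc : IsClosed (Λ : Set ℂ) := L.isClosed_lattice
  obtain ⟨r, hr, hrΛ⟩ : ∃ r > 0, ∀ x ∈ Λ, ‖x‖ < r → x = 0 := by
    obtain ⟨ε, hε, hball⟩ := Metric.exists_ball_inter_eq_singleton_of_mem_discrete
      (isDiscrete_iff_discreteTopology.mpr (inferInstance : DiscreteTopology L.lattice))
      (zero_mem L.lattice)
    refine ⟨ε, hε, fun x hx hxn ↦ ?_⟩
    have : x ∈ Metric.ball (0 : ℂ) ε ∩ (L.lattice : Set ℂ) := ⟨by simpa using hxn, hx⟩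
    rw [hball] at this
    exact this
  have hΛcount : (Λ : Set ℂ).Countable := by
    have : Countable L.lattice := Countable.of_equiv _ L.latticeEquivProd.toEquiv.symm
    exact Set.countable_coe_iff.mp this
  -- `Ψ` is `Γ₁(N)`-equivariant modulo `Λ`, holomorphic with `Ψ' = 2πi c f`, continuous
  have hΨΓ : ∀ γ ∈ Gamma1 N, ∀ τ : ℍ, Ψ (γ • τ) - Ψ τ ∈ Λ := by
    intro γ hγ τ
    have h1 := eichlerIntegral_smul_sub_holds f ⟨γ, Gamma1_in_Gamma0 N hγ⟩ τ
    have h2 := hc _ (cuspSymbol_mem_periodLatticeGamma1 f ⟨γ, hγ⟩)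
    have h3 : Ψ (γ • τ) - Ψ τ = c * cuspSymbol f ⟨γ, Gamma1_in_Gamma0 N hγ⟩ := by
      simp only [hΨdef, ← mul_sub, ← h1]
    rw [h3]
    exact h2
  have hderiv : ∀ z : ℂ, 0 < z.im →
      HasDerivAt (Ψ ∘ ofComplex) (c * (2 * Real.pi * Complex.I * f (ofComplex z))) z :=
    fun z hz ↦ (hasDerivAt_eichlerIntegral f hz).const_mul c
  have hdiff : DifferentiableOn ℂ (Ψ ∘ ofComplex) {z : ℂ | 0 < z.im} :=
    fun z hz ↦ (hderiv z hz).differentiableAt.differentiableWithinAt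
  have hΨc : Continuous Ψ := by
    have h2 : Ψ = (Ψ ∘ ofComplex) ∘ ((↑) : ℍ → ℂ) := by
      funext τ; simp [ofComplex_apply]
    rw [h2]
    exact hdiff.continuousOn.comp_continuous continuous_coe fun τ ↦ τ.im_pos
  -- local inverse at the non-zeros of `f`
  have hloc : ∀ τ : ℍ, f τ ≠ 0 → (∃ U ∈ 𝓝 τ, InjOn Ψ U) ∧ 𝓝 (Ψ τ) ≤ map Ψ (𝓝 τ) := by
    intro τ hτ
    refine exists_injOn_and_nhds_le_map hdiff (hderiv τ τ.im_pos) ?_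
    rw [ofComplex_apply]
    have : (2 * Real.pi * Complex.I : ℂ) ≠ 0 := by simp [Real.pi_ne_zero]
    exact mul_ne_zero hc0 (mul_ne_zero this hτ)
  -- reduction theory and the behaviour at the cusps
  obtain ⟨R, hR⟩ := exists_finset_smul_truncatedFundamentalDomain_cover (Gamma1 N)
  have hCg : ∀ g : SL(2, ℤ), ∃ C : ℂ, ∀ z : ℍ,
      Ψ (g • z) = C + c * verticalIntegral (⇑f ∣[(2 : ℤ)] g) z := by
    intro g
    obtain ⟨C, hC⟩ := exists_eichlerIntegral_smul_eq f g
    exact ⟨c * C, fun z ↦ by simp only [hΨdef, hC, mul_add]⟩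
  choose C hC using hCg
  have hCunif : ∀ ε > 0, ∃ M : ℝ, ∀ g ∈ R, ∀ z : ℍ, M ≤ z.im → ‖Ψ (g • z) - C g‖ < ε := by
    intro ε hε
    have hcn : 0 < ‖c‖ := norm_pos_iff.mpr hc0
    have : ∀ g ∈ R, ∀ᶠ M : ℝ in atTop, ∀ z : ℍ, M ≤ z.im → ‖Ψ (g • z) - C g‖ < ε := by
      intro g _
      obtain ⟨M, hM⟩ := (isCuspFunction_slash f g).exists_forall_norm_verticalIntegral_le
        (ε := ε / (2 * ‖c‖)) (by positivity)
      filter_upwards [eventually_ge_atTop M] with M' hM' z hz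
      rw [hC, add_sub_cancel_left, norm_mul]
      calc ‖c‖ * ‖verticalIntegral (⇑f ∣[(2 : ℤ)] g) z‖ ≤ ‖c‖ * (ε / (2 * ‖c‖)) := by
            gcongr; exact hM z (hM'.trans hz)
        _ = ε / 2 := by field_simp
        _ < ε := by linarith
    exact ((R.eventually_all).mpr this).exists
  -- the zeros of `f` and the exceptional set
  obtain ⟨F₀, hF₀, hZ⟩ := exists_finite_zeros_subset_gamma1_smul f hf
  set F₁ : Set ℂ := Ψ '' F₀ ∪ C '' (R : Set SL(2, ℤ)) with hF₁
  have hF₁fin : F₁.Finite := (hF₀.image Ψ).union (R.finite_toSet.image C)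
  set S' : Set ℂ := {w | ∃ x ∈ F₁, w - x ∈ Λ} with hS'
  have hS'count : S'.Countable := by
    have : S' = ⋃ x ∈ F₁, (fun l : ℂ ↦ x + l) '' (Λ : Set ℂ) := by
      ext w
      simp only [hS', mem_setOf_eq, mem_iUnion, mem_image, SetLike.mem_coe, exists_prop]
      constructor
      · rintro ⟨x, hx, hw⟩
        exact ⟨x, hx, w - x, hw, by ring⟩
      · rintro ⟨x, hx, l, hl, rfl⟩
        exact ⟨x, hx, by simpa using hl⟩
    rw [this]
    exact hF₁fin.countable.biUnion fun x _ ↦ hΛcount.image _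
  -- local constancy of the orbit count off `S'`
  have hmain : ∀ w₀, w₀ ∉ S' →
      Finite {y : MulAction.orbitRel.Quotient (Gamma1 N) ℍ //
        ∃ τ : ℍ, Quotient.mk (MulAction.orbitRel (Gamma1 N) ℍ) τ = y ∧ Ψ τ - w₀ ∈ Λ} ∧
      ∀ᶠ w in 𝓝 w₀,
        Nat.card {y : MulAction.orbitRel.Quotient (Gamma1 N) ℍ //
          ∃ τ : ℍ, Quotient.mk (MulAction.orbitRel (Gamma1 N) ℍ) τ = y ∧ Ψ τ - w ∈ Λ} =
        Nat.card {y : MulAction.orbitRel.Quotient (Gamma1 N) ℍ //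
          ∃ τ : ℍ, Quotient.mk (MulAction.orbitRel (Gamma1 N) ℍ) τ = y ∧ Ψ τ - w₀ ∈ Λ} := by
    intro w₀ hw₀
    have hw₀' : ∀ x ∈ F₁, w₀ - x ∉ Λ := fun x hx h ↦ hw₀ ⟨x, hx, h⟩
    have hcusp : ∀ g ∈ R, C g - w₀ ∉ Λ := by
      intro g hg h
      apply hw₀' (C g) (Or.inr ⟨g, hg, rfl⟩)
      simpa using Λ.neg_mem h
    obtain ⟨M, hred⟩ :=
      exists_eventually_forall_fiber_subset R hR hΨΓ hΛc C hCunif hcusp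
    refine finite_and_eventually_natCard_fiberOrbits_eq hΨc hΛc hr hrΛ hΨΓ
      (isCompact_biUnion_smul_truncatedFundamentalDomain R M) hred fun τ _ hτ ↦ hloc τ ?_
    intro hfτ
    obtain ⟨γ, hγ, z, hz, rfl⟩ := hZ τ hfτ
    apply hw₀' (Ψ z) (Or.inl ⟨z, hz, rfl⟩)
    simpa using Λ.sub_mem (hΨΓ γ hγ z) hτ
  -- the count as a function, constant on the connected set `S'ᶜ`
  set n : ℂ → ℕ := fun w ↦ Nat.card {y : MulAction.orbitRel.Quotient (Gamma1 N) ℍ //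
      ∃ τ : ℍ, Quotient.mk (MulAction.orbitRel (Gamma1 N) ℍ) τ = y ∧ Ψ τ - w ∈ Λ} with hn
  have hconst : ∀ w ∈ S'ᶜ, ∀ w' ∈ S'ᶜ, n w = n w' := by
    have hconn : IsConnected S'ᶜ :=
      hS'count.isConnected_compl_of_one_lt_rank (by rw [Complex.rank_real_complex]; norm_num)
    haveI := Subtype.preconnectedSpace hconn.isPreconnected
    have hlc : IsLocallyConstant (fun x : ↥(S'ᶜ) ↦ n x) := by
      refine (IsLocallyConstant.iff_eventually_eq _).mpr fun x ↦ ?_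
      exact continuous_subtype_val.continuousAt.eventually (hmain x.1 x.2).2
    intro w hw w' hw'
    have h := congr_fun (hlc.eq_const ⟨w, hw⟩) ⟨w', hw'⟩
    simp only [const_apply] at h
    exact h.symm
  -- a base point `w₁ ∉ S'` in the image of `Ψ`: there `n w₁ ≥ 1`
  obtain ⟨τ₀, hτ₀⟩ : ∃ τ₀ : ℍ, f τ₀ ≠ 0 := by
    by_contra h
    simp only [not_exists, not_not] at h
    exact hf (CuspForm.ext h)
  obtain ⟨w₁, hw₁S, σ₁, -, hσ₁⟩ : (S'ᶜ ∩ Ψ '' univ).Nonempty :=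
    (hS'count.dense_compl ℝ).inter_nhds_nonempty ((hloc τ₀ hτ₀).2 (image_mem_map univ_mem))
  have hd : 0 < n w₁ := by
    haveI := (hmain w₁ hw₁S).1
    refine Nat.card_pos_iff.mpr ⟨⟨⟨Quotient.mk _ σ₁, σ₁, rfl, ?_⟩⟩, inferInstance⟩
    simp [hσ₁, Λ.zero_mem]
  -- conclusion
  refine ⟨n w₁, hd, (hF₁fin.image (QuotientAddGroup.mk : ℂ → ℂ ⧸ Λ)).subset ?_⟩
  intro P hP
  by_contra hPF
  obtain ⟨w, rfl⟩ := QuotientAddGroup.mk_surjective P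
  have hwS : w ∈ S'ᶜ := by
    rintro ⟨x, hx, hwx⟩
    exact hPF ⟨x, hx, (QuotientAddGroup.eq_iff_sub_mem.mpr hwx).symm⟩
  apply hP
  rw [← hconst w hwS w₁ hw₁S, hn]
  refine Nat.card_congr (Equiv.subtypeEquivRight fun y ↦ ?_)
  simp only [QuotientAddGroup.eq_iff_sub_mem]
  rfl

/-- Transport of the orbit-fibre count along a bijection of the target (`Γ₁(N)` twin of `card_fiberOrbits_congr`).
[folklore] -/
theorem natCard_gamma1FiberOrbits_congr {A B : Type*} (e : A ≃ B) (g : ℍ → A) (P : A) :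
    Nat.card {y : Y1 N // ∃ τ : ℍ, Y1.mk N τ = y ∧ e (g τ) = e P} =
      Nat.card {y : Y1 N // ∃ τ : ℍ, Y1.mk N τ = y ∧ g τ = P} :=
  Nat.card_congr <| Equiv.subtypeEquivRight fun _ ↦
    exists_congr fun _ ↦ and_congr_right fun _ ↦ e.injective.eq_iff

/-- Finiteness of the exceptional set `{P | #(Γ₁(N)-orbit fibre over P) ≠ d}` is invariant under a bijection of the target
(`Γ₁(N)` twin of `finite_setOf_card_fiberOrbits_ne_iff`). [folklore] -/
theorem finite_setOf_natCard_gamma1FiberOrbits_ne_iff {A B : Type*} (e : A ≃ B) (g : ℍ → A) (d : ℕ) :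
    {Q : B | Nat.card {y : Y1 N // ∃ τ : ℍ, Y1.mk N τ = y ∧ e (g τ) = Q} ≠ d}.Finite ↔
      {P : A | Nat.card {y : Y1 N // ∃ τ : ℍ, Y1.mk N τ = y ∧ g τ = P} ≠ d}.Finite := by
  have hS : {Q : B | Nat.card {y : Y1 N // ∃ τ : ℍ, Y1.mk N τ = y ∧ e (g τ) = Q} ≠ d} =
      e '' {P : A | Nat.card {y : Y1 N // ∃ τ : ℍ, Y1.mk N τ = y ∧ g τ = P} ≠ d} := by
    ext Q
    simp only [Set.mem_setOf_eq, Set.mem_image]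
    constructor
    · intro hQ
      refine ⟨e.symm Q, ?_, e.apply_symm_apply Q⟩
      rwa [← natCard_gamma1FiberOrbits_congr e g, e.apply_symm_apply]
    · rintro ⟨P, hP, rfl⟩
      rwa [natCard_gamma1FiberOrbits_congr e g]
  rw [hS, Set.finite_image_iff e.injective.injOn]

end Degree

/-! ## §2 The flat `X₁(N)`-datum on the `X₀(N)`-optimal curve -/

section Flat

variable {W₀ : WeierstrassCurve ℚ} {N : ℕ} [NeZero N]

/-- **The flat `X₁(N)`-datum.**  Let `D₀` be an `X₀(N)`-parametrisation datum of `W₀` with the lattice clause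
`Λ_{W₀} = c₀·Λ₀(f)` (optimal parametrisation), with `c₀` EVEN, in the index-`4` configuration `Λ₁(f) = 2Λ₀(f)`.  Then `W₀` itself
carries an OPTIMAL `X₁(N)`-datum `D₁` (`Λ_{W₀} = c₁·Λ₁(f)`) with the same newform, the same Néron lattice, the same uniformisation
`π₀`, and `2c₁ = c₀`: the datum `(f, Λ_{W₀}, π₀, c₀/2)`, whose degree field is supplied by `exists_gamma1_modularDegree` transported
along `ℂ/Λ_{W₀} ≃ W₀(ℂ)` (`QuotientAddGroup.liftEquiv`).  In words: when the Shimura kernel is `E₀[2]` and `c₀ = ±2`, the map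
`τ ↦ π₀(±2πi∫_{i∞}^τ f)` is already `Γ₁(N)`-invariant and IS an optimal `X₁(N)`-parametrisation of `W₀` — so in this world the
printed existence fact CES (`exists_optimal_gamma1ParametrizationData`) is not needed.  Existence only; no definition.
[cite: CesnaviciusNeururerSaha2023, §1 and Lemma 6.5] [cite: FarkasKra1992, Prop. I.1.6] -/
theorem exists_flat_gamma1ParametrizationData [W₀.IsElliptic] (D₀ : ModularParametrizationData W₀ N)
    (hopt : ∀ z ∈ D₀.L.lattice, ∃ w ∈ periodLattice D₀.f, z = D₀.c * w) (heven : (2 : ℤ) ∣ D₀.c)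
    (h4 : ∀ z : ℂ, z ∈ periodLatticeGamma1 D₀.f ↔ ∃ w ∈ periodLattice D₀.f, z = 2 * w) :
    ∃ D₁ : Gamma1ParametrizationData W₀ N, D₁.IsOptimal ∧ D₁.f = D₀.f ∧ D₁.L = D₀.L ∧
      D₁.uniformize = D₀.uniformize ∧ 2 * D₁.c = D₀.c := by
  obtain ⟨c₁, hc₁⟩ := heven
  have hf : D₀.f ≠ 0 := D₀.isNewformOf.1.ne_zero
  have hc₀ : D₀.c ≠ 0 := D₀.maninConstant_ne_zero_holds
  have hc₁0 : (c₁ : ℂ) ≠ 0 := by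
    have : c₁ ≠ 0 := by rintro rfl; exact hc₀ (by rw [hc₁, mul_zero])
    exact_mod_cast this
  -- `c₁ Λ₁(f) ⊆ Λ_{W₀}`
  have hc : ∀ z ∈ periodLatticeGamma1 D₀.f, (c₁ : ℂ) * z ∈ D₀.L.lattice := by
    intro z hz
    obtain ⟨w, hw, rfl⟩ := (h4 z).mp hz
    have e : (c₁ : ℂ) * (2 * w) = (D₀.c : ℂ) * w := by rw [hc₁]; push_cast; ring
    rw [e]
    exact D₀.smul_periodLattice_le w hw
  -- the degree over `Γ₁(N)`-orbits, on `ℂ/Λ`, transported to `W₀(ℂ)` along `π₀`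
  obtain ⟨d, hd, hfin⟩ := exists_gamma1_modularDegree hf hc₁0 hc
  have hker' : D₀.L.lattice.toAddSubgroup = D₀.uniformize.ker :=
    SetLike.coe_injective (by rw [Submodule.coe_toAddSubgroup, D₀.ker_uniformize])
  let e : ℂ ⧸ D₀.L.lattice.toAddSubgroup ≃+ (W₀.baseChange ℂ).toAffine.Point :=
    QuotientAddGroup.liftEquiv D₀.L.lattice.toAddSubgroup D₀.uniformize_surjective hker'
  have he : ∀ x : ℂ, e.toEquiv (x : ℂ ⧸ D₀.L.lattice.toAddSubgroup) = D₀.uniformize x := fun _ ↦ rfl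
  have key := (finite_setOf_natCard_gamma1FiberOrbits_ne_iff e.toEquiv
    (fun τ : ℍ ↦ (((c₁ : ℂ) * eichlerIntegral D₀.f τ : ℂ) : ℂ ⧸ D₀.L.lattice.toAddSubgroup)) d).mpr hfin
  simp only [he] at key
  refine ⟨{
    f := D₀.f
    isNewformOf := D₀.isNewformOf
    L := D₀.L
    isNeronLattice := D₀.isNeronLattice
    uniformize := D₀.uniformize
    ker_uniformize := D₀.ker_uniformize
    uniformize_surjective := D₀.uniformize_surjective
    uniformize_spec := D₀.uniformize_spec
    c := c₁
    smul_periodLatticeGamma1_le := hc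
    deg := d
    deg_pos := hd
    deg_spec := key }, ?_, rfl, rfl, rfl, ?_⟩
  · -- optimality: `Λ_{W₀} = c₀Λ₀(f) = c₁·(2Λ₀(f)) = c₁Λ₁(f)`
    intro z hz
    obtain ⟨w, hw, rfl⟩ := hopt z hz
    refine ⟨2 * w, (h4 _).mpr ⟨w, hw, rfl⟩, ?_⟩
    change (D₀.c : ℂ) * w = (c₁ : ℂ) * (2 * w)
    rw [hc₁]; push_cast; ring
  · change 2 * c₁ = D₀.c
    rw [hc₁]

end Flat

/-! ## §3 The general `X₁(N)`-datum on the curve of an `X₀(N)`-datum (APPEND, p2 gen 22) -/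

section General

variable {W₀ : WeierstrassCurve ℚ} {N : ℕ} [NeZero N]

/-- **Every `X₀(N)`-datum `D₀` of `W₀` and every non-zero integer `c` with `c·Λ₁(f) ⊆ Λ_{W₀}` give an `X₁(N)`-datum `D₁` of `W₀` with the same
newform, the same Néron lattice, the same uniformisation and `D₁.c = c`** (optimal or not; the degree field from `exists_gamma1_modularDegree`).
General form of `exists_flat_gamma1ParametrizationData` (`c = c₀/2` there); e.g. `c = c₀` always qualifies (`Λ₁(f) ⊆ Λ₀(f)`,
`exists_gamma1ParametrizationData_of_datum`), and `c = 1` qualifies whenever `Λ₁(f) ⊆ Λ_{W₀}` (Stevens' inclusion, e.g. modulo CDT).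
Existence only; no definition. [cite: CesnaviciusNeururerSaha2023, §1] [cite: FarkasKra1992, Prop. I.1.6] -/
theorem exists_gamma1ParametrizationData_of_smul_le [W₀.IsElliptic] (D₀ : ModularParametrizationData W₀ N) {c : ℤ} (hc0 : c ≠ 0)
    (hc : ∀ z ∈ periodLatticeGamma1 D₀.f, (c : ℂ) * z ∈ D₀.L.lattice) :
    ∃ D₁ : Gamma1ParametrizationData W₀ N, D₁.f = D₀.f ∧ D₁.L = D₀.L ∧ D₁.uniformize = D₀.uniformize ∧ D₁.c = c := by
  have hf : D₀.f ≠ 0 := D₀.isNewformOf.1.ne_zero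
  have hc0' : (c : ℂ) ≠ 0 := by exact_mod_cast hc0
  obtain ⟨d, hd, hfin⟩ := exists_gamma1_modularDegree hf hc0' hc
  have hker' : D₀.L.lattice.toAddSubgroup = D₀.uniformize.ker :=
    SetLike.coe_injective (by rw [Submodule.coe_toAddSubgroup, D₀.ker_uniformize])
  let e : ℂ ⧸ D₀.L.lattice.toAddSubgroup ≃+ (W₀.baseChange ℂ).toAffine.Point :=
    QuotientAddGroup.liftEquiv D₀.L.lattice.toAddSubgroup D₀.uniformize_surjective hker'
  have he : ∀ x : ℂ, e.toEquiv (x : ℂ ⧸ D₀.L.lattice.toAddSubgroup) = D₀.uniformize x := fun _ ↦ rfl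
  have key := (finite_setOf_natCard_gamma1FiberOrbits_ne_iff e.toEquiv
    (fun τ : ℍ ↦ (((c : ℂ) * eichlerIntegral D₀.f τ : ℂ) : ℂ ⧸ D₀.L.lattice.toAddSubgroup)) d).mpr hfin
  simp only [he] at key
  exact ⟨{
    f := D₀.f
    isNewformOf := D₀.isNewformOf
    L := D₀.L
    isNeronLattice := D₀.isNeronLattice
    uniformize := D₀.uniformize
    ker_uniformize := D₀.ker_uniformize
    uniformize_surjective := D₀.uniformize_surjective
    uniformize_spec := D₀.uniformize_spec
    c := c
    smul_periodLatticeGamma1_le := hc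
    deg := d
    deg_pos := hd
    deg_spec := key }, rfl, rfl, rfl, rfl⟩

/-- **Every `X₀(N)`-datum restricts to an `X₁(N)`-datum with the same Manin constant** (`Λ₁(f) ⊆ Λ₀(f)` and `c₀Λ₀(f) ⊆ Λ_{W₀}`): the converse of
the tree's `CDivision.nonempty_modularParametrizationData_of_gamma1`.  [cite: CesnaviciusNeururerSaha2023, §1] [cite: Manin1972, Prop. 1.4] -/
theorem exists_gamma1ParametrizationData_of_datum [W₀.IsElliptic] (D₀ : ModularParametrizationData W₀ N) :
    ∃ D₁ : Gamma1ParametrizationData W₀ N, D₁.f = D₀.f ∧ D₁.L = D₀.L ∧ D₁.uniformize = D₀.uniformize ∧ D₁.c = D₀.c :=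
  exists_gamma1ParametrizationData_of_smul_le D₀ D₀.maninConstant_ne_zero_holds fun z hz ↦
    D₀.smul_periodLattice_le z (periodLatticeGamma1_le_periodLattice D₀.f hz)

/-- **Under Stevens' inclusion `Λ₁(f) ⊆ Λ_{W₀}` (e.g. modulo CDT, `CDivisionInt.periodLatticeGamma1_le_neron_of_CDTInt`) the curve of every
`X₀(N)`-datum carries an `X₁(N)`-datum with Manin constant `1`** (not optimal in general).  [cite: Stevens1989, §2] [cite: CesnaviciusNeururerSaha2023, §1] -/
theorem exists_gamma1ParametrizationData_one_of_gamma1Periods_le [W₀.IsElliptic] (D₀ : ModularParametrizationData W₀ N)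
    (hSI : ∀ z ∈ periodLatticeGamma1 D₀.f, z ∈ D₀.L.lattice) :
    ∃ D₁ : Gamma1ParametrizationData W₀ N, D₁.f = D₀.f ∧ D₁.L = D₀.L ∧ D₁.uniformize = D₀.uniformize ∧ D₁.c = 1 :=
  exists_gamma1ParametrizationData_of_smul_le D₀ one_ne_zero fun z hz ↦ by
    rw [Int.cast_one, one_mul]; exact hSI z hz

end General

end Summit.BirchSwinnertonDyer.BirchSwinnertonDyer.Theorems.ManinLocalTwoThree.FlatGamma1Datum

end
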